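import Mathlib.Analysis.Complex.BorelCaratheodory
import Mathlib.Analysis.Complex.Hadamard
import Mathlib.Analysis.Complex.HasPrimitives
import Mathlib.Analysis.SpecialFunctions.Complex.LogBounds
import Mathlib.Analysis.SpecialFunctions.Complex.LogDeriv
import Mathlib.Analysis.Real.Pi.Bounds
import Mathlib.Analysis.Complex.ExponentialBounds
import Mathlib.NumberTheory.ZetaValues
import Mathlib.NumberTheory.LSeries.RiemannZeta
import Literature.NumberTheory.LFunctions.ZetaFractionalPartIntegral
import HarnessLib

/-!
# Littlewood's bound `1/ζ(s) = O(t^ε)` on `σ > 1/2` under RH (Titchmarsh Thm. 14.2, (14.2.6))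

Topic: `Literature/NumberTheory/LFunctions`. A complete proof, from Mathlib and the tree, of
Littlewood's theorem (J. E. Littlewood, C. R. Acad. Sci. Paris 154 (1912), 263–266) in the form of
Titchmarsh, *The Theory of the Riemann Zeta-Function*, 2nd ed. (1986), Thm. 14.2, eq. (14.2.6):
on the Riemann hypothesis, `1/ζ(s) = O(t^ε)` for every `σ > 1/2` (uniformly in
`σ ≥ σ₀ > 1/2`). This is the analytic input of the necessity half RH ⇒ `M(x) = O(x^{1/2+ε})` of
Littlewood's criterion (Titchmarsh Thm. 14.25 (C); `MertensBoundRH.lean` vendors it as the named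
fact `Literature.MertensBoundRH.Titchmarsh1986_eq_14_2_6`, whose statement is literally
`Literature.NumberTheory.LFunctions.InvZetaRH.norm_inv_riemannZeta_le_rpow` below).

The proof is Titchmarsh's (§14.2), with the discs centred at `3 + it` instead of `2 + it` and
`σ₁ + it` (a fixed centre suffices for an exponent `< 1`, which is all (14.2.6) needs):

* `exists_log_of_ball`: a zero-free holomorphic `f` on a disc has a holomorphic logarithm there
  (primitive of `f'/f`, Mathlib `DifferentiableOn.isExactOn_ball`); under RH this applies to `ζ`
  on `‖z − (3+it)‖ < 5/2 − δ/2 ⊂ {Re z > 1/2}` (`|t| ≥ 7` keeps the pole away).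
* `norm_le_of_three_circles`: Hadamard's three-circles theorem, from Mathlib's three-lines
  theorem (`Complex.HadamardThreeLines`) through `z = c + e^w`.
* (14.2.2) `exists_log_riemannZeta`: Borel–Carathéodory (Mathlib `Complex.borelCaratheodory`) on
  the disc of radius `5/2 − δ/2`, using `Re log ζ = log|ζ| ≤ 2 log|t|` (from
  `‖ζ(s)‖ ≤ ‖s‖/‖s−1‖ + ‖s‖/σ`, Titchmarsh (2.12.2), `ZetaFractionalPartIntegral.lean`) and
  `‖log ζ(3+it)‖ ≤ B₁` (`‖ζ − 1‖ ≤ ζ(2) − 1 = π²/6 − 1 < 1` on `Re s ≥ 2`), giving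
  `‖log ζ(z)‖ ≤ A₃ δ⁻¹ log|t|` for `‖z − (3+it)‖ ≤ 5/2 − δ`.
* `norm_log_le_rpow`: three circles centred `3+it` through `5/2+it` (where `‖log ζ‖ ≤ B₂`),
  `σ+it`, `1/2+δ+it`: `‖log ζ(σ+it)‖ ≤ B₂ (A₃δ⁻¹ log|t|)^{a₀(δ)}` with
  `a₀(δ) = log(5−4δ)/log(5−2δ) < 1` for `1/2 + 2δ ≤ σ ≤ 5/2`.
* `norm_inv_riemannZeta_le_rpow` ((14.2.6)): hence `log|1/ζ(σ+it)| ≤ ε log|t|` for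
  `log|t| ≥ (B₂A₃/(δε))^{1/(1−a₀)}`, i.e. `‖1/ζ(σ+it)‖ ≤ |t|^ε`; for `σ > 5/2` trivially.

## Main results (all proved, no named facts)

* `Literature.NumberTheory.LFunctions.InvZetaRH.norm_le_of_three_circles` — Hadamard's three-circles theorem.
* `Literature.NumberTheory.LFunctions.InvZetaRH.exists_log_of_ball` — holomorphic logarithms on discs.
* `Literature.NumberTheory.LFunctions.InvZetaRH.exists_log_riemannZeta` — Titchmarsh (14.2.2) (Borel–Carathéodory step).
* `Literature.NumberTheory.LFunctions.InvZetaRH.norm_inv_riemannZeta_le_rpow` — Titchmarsh (14.2.6): under RH, for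
  `σ₀ > 1/2`, `ε > 0` there is `T` with `‖ζ(σ+it)⁻¹‖ ≤ |t|^ε` for `σ ≥ σ₀`, `|t| ≥ T`.

## References

* E. C. Titchmarsh, *The Theory of the Riemann Zeta-Function*, 2nd ed. revised by
  D. R. Heath-Brown, Oxford 1986, §14.2: Thm. 14.2 and eqs. (14.2.1)–(14.2.6).
* J. E. Littlewood, *Quelques conséquences de l'hypothèse que la fonction ζ(s) n'a pas de zéros
  dans le demi-plan Re(s) > 1/2*, C. R. Acad. Sci. Paris 154 (1912), 263–266.

## Design choices

* Constants are explicit but crude (`A₃ = 20 + 10B₁`, `B₁ = ρ²/(2(1−ρ)) + ρ`, `ρ = π²/6 − 1`);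
  only `a₀ < 1` matters. The sharper exponent `2 − 2σ + ε` of (14.2.1) (centre `σ₁ → ∞`) is not
  pursued.
* Negative `t` is covered directly (the discs are symmetric), so no appeal to `ζ(s̄) = conj ζ(s)`.
-/

noncomputable section

open Complex Filter Topology Metric Set
open scoped Real

namespace Literature.NumberTheory.LFunctions

namespace InvZetaRH


/-- **Hadamard's three-circles theorem** (from Mathlib's three-lines theorem via `z = c + e^w`):
if `F` is holomorphic on the disc `‖z - c‖ < R`, `0 < r₁ < r₃ < R`, `‖F‖ ≤ M₁` on the circle
`‖z - c‖ = r₁` and `‖F‖ ≤ M₃` on `‖z - c‖ = r₃`, then for `r₁ ≤ ‖z - c‖ ≤ r₃`,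
`‖F z‖ ≤ M₁^{1-a} M₃^{a}` with `a = log(‖z-c‖/r₁)/log(r₃/r₁)`. [folklore] -/
theorem norm_le_of_three_circles {F : ℂ → ℂ} {c : ℂ} {R r₁ r₃ M₁ M₃ : ℝ} (hr₁ : 0 < r₁)
    (h13 : r₁ < r₃) (h3R : r₃ < R) (hF : DifferentiableOn ℂ F (ball c R))
    (hM₁ : ∀ z : ℂ, ‖z - c‖ = r₁ → ‖F z‖ ≤ M₁) (hM₃ : ∀ z : ℂ, ‖z - c‖ = r₃ → ‖F z‖ ≤ M₃)
    {z : ℂ} (hz₁ : r₁ ≤ ‖z - c‖) (hz₃ : ‖z - c‖ ≤ r₃) :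
    ‖F z‖ ≤ M₁ ^ (1 - Real.log (‖z - c‖ / r₁) / Real.log (r₃ / r₁)) *
      M₃ ^ (Real.log (‖z - c‖ / r₁) / Real.log (r₃ / r₁)) := by
  have hr₃ : 0 < r₃ := hr₁.trans h13
  set l : ℝ := Real.log r₁ with hl
  set u : ℝ := Real.log r₃ with hu
  have hlu : l < u := Real.log_lt_log hr₁ h13
  -- the pulled-back function on the strip
  set g : ℂ → ℂ := fun w => F (c + exp w) with hg
  have hmem : ∀ w : ℂ, w.re ≤ u → c + exp w ∈ ball c R := by
    intro w hw
    rw [mem_ball, dist_eq_norm, add_sub_cancel_left, norm_exp]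
    calc Real.exp w.re ≤ Real.exp u := Real.exp_le_exp.mpr hw
      _ = r₃ := by rw [hu, Real.exp_log hr₃]
      _ < R := h3R
  have hgd : DifferentiableOn ℂ g (closure (HadamardThreeLines.verticalStrip l u)) := by
    intro w hw
    have hw' : w.re ≤ u := by
      rw [HadamardThreeLines.verticalStrip, closure_preimage_re, closure_Ioo hlu.ne] at hw
      exact hw.2
    refine DifferentiableAt.differentiableWithinAt ?_
    have hFat : DifferentiableAt ℂ F (c + exp w) :=
      hF.differentiableAt (isOpen_ball.mem_nhds (hmem w hw'))
    exact hFat.comp w ((differentiableAt_const c).add differentiableAt_exp)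
  have hd : DiffContOnCl ℂ g (HadamardThreeLines.verticalStrip l u) := hgd.diffContOnCl
  -- boundedness on the closed strip: `F` is bounded on the compact closed disc of radius `r₃`
  obtain ⟨B, hB⟩ := (isCompact_closedBall c r₃).exists_bound_of_continuousOn
    (hF.continuousOn.mono (closedBall_subset_ball h3R))
  have hBdd : BddAbove ((norm ∘ g) '' HadamardThreeLines.verticalClosedStrip l u) := by
    refine ⟨B, ?_⟩
    rintro _ ⟨w, hw, rfl⟩
    simp only [Function.comp_apply, hg]
    refine hB _ ?_
    rw [mem_closedBall, dist_eq_norm, add_sub_cancel_left, norm_exp, ← Real.exp_log hr₃]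
    exact Real.exp_le_exp.mpr hw.2
  -- edge bounds
  have hnorm : ∀ w : ℂ, ‖c + exp w - c‖ = Real.exp w.re := fun w => by
    rw [add_sub_cancel_left, norm_exp]
  have ha : ∀ w ∈ re ⁻¹' {l}, ‖g w‖ ≤ M₁ := by
    intro w hw
    have hw' : w.re = l := hw
    exact hM₁ _ (by rw [hnorm, hw', hl, Real.exp_log hr₁])
  have hb : ∀ w ∈ re ⁻¹' {u}, ‖g w‖ ≤ M₃ := by
    intro w hw
    have hw' : w.re = u := hw
    exact hM₃ _ (by rw [hnorm, hw', hu, Real.exp_log hr₃])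
  -- the point `w₀ = log (z - c)`
  have hzc : z - c ≠ 0 := by
    intro h0; rw [h0, norm_zero] at hz₁; linarith
  have hzpos : 0 < ‖z - c‖ := norm_pos_iff.mpr hzc
  set w₀ : ℂ := log (z - c) with hw₀
  have hw₀re : w₀.re = Real.log ‖z - c‖ := by rw [hw₀, log_re]
  have hw₀mem : w₀ ∈ HadamardThreeLines.verticalClosedStrip l u := by
    refine ⟨?_, ?_⟩
    · rw [hw₀re, hl]; exact Real.log_le_log hr₁ hz₁
    · rw [hw₀re, hu]; exact Real.log_le_log hzpos hz₃
  have hgz : g w₀ = F z := by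
    simp only [hg, hw₀, exp_log hzc, add_sub_cancel]
  have key := HadamardThreeLines.norm_le_interp_of_mem_verticalClosedStrip' hlu hw₀mem hd hBdd
    ha hb
  rw [hgz, hw₀re] at key
  have hexp : (Real.log ‖z - c‖ - l) / (u - l) = Real.log (‖z - c‖ / r₁) / Real.log (r₃ / r₁) := by
    rw [hl, hu, ← Real.log_div hzpos.ne' hr₁.ne', ← Real.log_div hr₃.ne' hr₁.ne']
  rw [hexp] at key
  exact key

/-- **Holomorphic logarithms on a disc.** A holomorphic, zero-free `f` on the disc `‖z - c‖ < R`
has a holomorphic logarithm `L` there (`exp ∘ L = f`), normalised by `L c = log (f c)`, with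
`L' = f'/f`; from Mathlib's existence of primitives on discs (`DifferentiableOn.isExactOn_ball`)
applied to `f'/f`. [folklore] -/
theorem exists_log_of_ball {f : ℂ → ℂ} {c : ℂ} {R : ℝ} (hR : 0 < R)
    (hf : DifferentiableOn ℂ f (ball c R)) (hf0 : ∀ z ∈ ball c R, f z ≠ 0) :
    ∃ L : ℂ → ℂ, DifferentiableOn ℂ L (ball c R) ∧ L c = log (f c) ∧
      (∀ z ∈ ball c R, HasDerivAt L (deriv f z / f z) z) ∧ ∀ z ∈ ball c R, exp (L z) = f z := by
  set q : ℂ → ℂ := fun z => deriv f z / f z with hq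
  have hqd : DifferentiableOn ℂ q (ball c R) := (hf.deriv isOpen_ball).div hf hf0
  obtain ⟨g, hg⟩ := hqd.isExactOn_ball
  set L : ℂ → ℂ := fun z => g z - g c + log (f c) with hL
  have hLd : ∀ z ∈ ball c R, HasDerivAt L (q z) z := by
    intro z hz
    have := ((hg z hz).sub_const (g c)).add_const (log (f c))
    simpa [hL] using this
  have hLdiff : DifferentiableOn ℂ L (ball c R) :=
    fun z hz => (hLd z hz).differentiableAt.differentiableWithinAt
  refine ⟨L, hLdiff, by simp [hL], hLd, ?_⟩
  -- `h = f · exp (-L)` has zero derivative on the disc, hence is constant `= h c = 1`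
  set h : ℂ → ℂ := fun z => f z * exp (-L z) with hh
  have hhd : ∀ z ∈ ball c R, HasDerivAt h 0 z := by
    intro z hz
    have h1 : HasDerivAt f (deriv f z) z :=
      (hf.differentiableAt (isOpen_ball.mem_nhds hz)).hasDerivAt
    have h2 : HasDerivAt (fun w => exp (-L w)) (exp (-L z) * -q z) z := (hLd z hz).neg.cexp
    have h3 := h1.mul h2
    have hzero : deriv f z * exp (-L z) + f z * (exp (-L z) * -q z) = 0 := by
      rw [hq]; field_simp [hf0 z hz]; ring
    rw [hzero] at h3
    exact h3
  have hdiffh : DifferentiableOn ℂ h (ball c R) :=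
    fun z hz => (hhd z hz).differentiableAt.differentiableWithinAt
  have hderiv : (ball c R).EqOn (deriv h) 0 := fun z hz => (hhd z hz).deriv
  intro z hz
  have hconst := isOpen_ball.is_const_of_deriv_eq_zero (convex_ball c R).isPreconnected hdiffh
    hderiv hz (mem_ball_self hR)
  have hc1 : h c = 1 := by
    simp only [hh, hL, sub_self, zero_add, exp_neg, exp_log (hf0 c (mem_ball_self hR))]
    exact mul_inv_cancel₀ (hf0 c (mem_ball_self hR))
  rw [hc1] at hconst
  -- `f z * exp (-L z) = 1`
  have : f z * exp (-L z) = 1 := hconst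
  rw [exp_neg, mul_inv_eq_one₀ (exp_ne_zero _)] at this
  exact this.symm



/-! ### `ζ` on the half-plane `Re s ≥ 2` -/

/-- `ρ = π²/6 − 1 = ζ(2) − 1`, the bound for `‖ζ(s) − 1‖` on `Re s ≥ 2`. [folklore] -/
def rho : ℝ := π ^ 2 / 6 - 1

/-- `ρ < 1` (as `π² < 12`). [folklore] -/
lemma rho_lt_one : rho < 1 := by
  have := Real.pi_lt_d2
  have h0 := Real.pi_pos
  unfold rho
  nlinarith

/-- `0 < ρ` (as `π > 3`). [folklore] -/
lemma rho_pos : 0 < rho := by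
  have := Real.pi_gt_three
  unfold rho
  nlinarith

/-- `∑_{n ≥ 2} n^{-2} = π²/6 − 1`. [folklore] -/
lemma hasSum_one_div_sq_add_two :
    HasSum (fun n : ℕ => 1 / ((n : ℝ) + 2) ^ 2) rho := by
  have h := (hasSum_nat_add_iff' 2).mpr hasSum_zeta_two
  simp only [Finset.sum_range_succ, Finset.sum_range_zero, Nat.cast_zero, Nat.cast_one,
    zero_add] at h
  have h2 : π ^ 2 / 6 - (1 / (0 : ℝ) ^ 2 + 1 / (1 : ℝ) ^ 2) = rho := by unfold rho; norm_num
  have hf : (fun n : ℕ => 1 / ((n : ℝ) + 2) ^ 2) = fun n : ℕ => 1 / ((n + 2 : ℕ) : ℝ) ^ 2 := by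
    ext n; push_cast; ring
  rw [hf, ← h2]
  exact h

/-- For `Re s ≥ 2`: `‖ζ(s) − 1‖ ≤ ∑_{n≥2} n^{-2} = π²/6 − 1`. [folklore] -/
lemma norm_riemannZeta_sub_one_le {s : ℂ} (hs : 2 ≤ s.re) : ‖riemannZeta s - 1‖ ≤ rho := by
  have hs1 : 1 < s.re := by linarith
  have hsum : Summable fun n : ℕ => 1 / (n : ℂ) ^ s := Complex.summable_one_div_nat_cpow.mpr hs1
  have hsum1 : Summable fun n : ℕ => 1 / ((n + 1 : ℕ) : ℂ) ^ s := (summable_nat_add_iff 1).mpr hsum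
  have hzeta : riemannZeta s = ∑' n : ℕ, 1 / ((n + 1 : ℕ) : ℂ) ^ s := by
    rw [zeta_eq_tsum_one_div_nat_add_one_cpow hs1]
    congr 1; ext n; push_cast; ring
  have hsplit : riemannZeta s - 1 = ∑' n : ℕ, 1 / ((n + 2 : ℕ) : ℂ) ^ s := by
    rw [hzeta, hsum1.tsum_eq_zero_add]
    simp only [zero_add, Nat.cast_one, one_cpow, div_one, add_sub_cancel_left]
  rw [hsplit]
  refine tsum_of_norm_bounded hasSum_one_div_sq_add_two fun n => ?_
  rw [norm_div, norm_one, Complex.norm_natCast_cpow_of_pos (by omega)]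
  have hn2 : (2 : ℝ) ≤ ((n + 2 : ℕ) : ℝ) := by exact_mod_cast Nat.le_add_left 2 n
  have h1 : ((n + 2 : ℕ) : ℝ) ^ (2 : ℝ) ≤ ((n + 2 : ℕ) : ℝ) ^ s.re :=
    Real.rpow_le_rpow_of_exponent_le (by linarith) hs
  calc 1 / ((n + 2 : ℕ) : ℝ) ^ s.re ≤ 1 / ((n + 2 : ℕ) : ℝ) ^ (2 : ℝ) :=
        one_div_le_one_div_of_le (by positivity) h1
    _ = 1 / ((n : ℝ) + 2) ^ 2 := by push_cast; norm_num

/-- For `Re s ≥ 2`, `ζ(s)` lies in the slit plane (indeed `‖ζ(s) − 1‖ < 1`). [folklore] -/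
lemma riemannZeta_mem_slitPlane {s : ℂ} (hs : 2 ≤ s.re) : riemannZeta s ∈ slitPlane := by
  have h := mem_slitPlane_of_norm_lt_one ((norm_riemannZeta_sub_one_le hs).trans_lt rho_lt_one)
  rwa [add_sub_cancel] at h

/-- The constant `B₁ = ρ²/(2(1−ρ)) + ρ` bounding `‖log ζ(s)‖` on `Re s ≥ 2`. [folklore] -/
def B₁ : ℝ := rho ^ 2 * (1 - rho)⁻¹ / 2 + rho

/-- `0 < B₁`. [folklore] -/
lemma B₁_pos : 0 < B₁ := by
  have h1 := rho_lt_one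
  have h2 := rho_pos
  unfold B₁
  have : 0 < (1 - rho)⁻¹ := inv_pos.mpr (by linarith)
  positivity

/-- For `Re s ≥ 2`: `‖log ζ(s)‖ ≤ B₁` (principal logarithm; `ζ(s) = 1 + w`, `‖w‖ ≤ ρ < 1`).
[folklore] -/
lemma norm_log_riemannZeta_le {s : ℂ} (hs : 2 ≤ s.re) : ‖log (riemannZeta s)‖ ≤ B₁ := by
  set w : ℂ := riemannZeta s - 1 with hw
  have hw1 : ‖w‖ ≤ rho := norm_riemannZeta_sub_one_le hs
  have hw2 : ‖w‖ < 1 := hw1.trans_lt rho_lt_one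
  have heq : riemannZeta s = 1 + w := by rw [hw]; ring
  rw [heq]
  refine (norm_log_one_add_le hw2).trans ?_
  unfold B₁
  have h1 := rho_lt_one
  have hinv : (1 - ‖w‖)⁻¹ ≤ (1 - rho)⁻¹ := by
    apply inv_anti₀ (by linarith); linarith
  have hinv0 : 0 ≤ (1 - ‖w‖)⁻¹ := inv_nonneg.mpr (by linarith)
  gcongr

/-- For `Re s ≥ 2`: `‖ζ(s)⁻¹‖ ≤ (1 − ρ)⁻¹`. [folklore] -/
lemma norm_inv_riemannZeta_le_of_two_le {s : ℂ} (hs : 2 ≤ s.re) :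
    ‖(riemannZeta s)⁻¹‖ ≤ (1 - rho)⁻¹ := by
  have hw1 : ‖riemannZeta s - 1‖ ≤ rho := norm_riemannZeta_sub_one_le hs
  have h1 := rho_lt_one
  have hlow : 1 - rho ≤ ‖riemannZeta s‖ := by
    have h := norm_sub_norm_le (1 : ℂ) (1 - riemannZeta s)
    rw [show (1 : ℂ) - (1 - riemannZeta s) = riemannZeta s by ring, norm_sub_rev, norm_one] at h
    linarith
  rw [norm_inv]
  exact inv_anti₀ (by linarith) hlow

/-! ### `ζ` under RH on `Re s > 1/2` -/

/-- Under RH, `ζ(s) ≠ 0` for `Re s > 1/2`. [folklore] -/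
lemma riemannZeta_ne_zero_of_RH (hRH : RiemannHypothesis) {s : ℂ} (hs : 1 / 2 < s.re) :
    riemannZeta s ≠ 0 := by
  intro h0
  by_cases h1 : s = 1
  · exact riemannZeta_one_ne_zero (h1 ▸ h0)
  have htriv : ¬∃ n : ℕ, s = -2 * (n + 1) := by
    rintro ⟨n, rfl⟩
    simp only [mul_re, neg_re, re_ofNat, add_re, natCast_re, one_re, neg_im, im_ofNat, neg_zero,
      add_im, natCast_im, one_im, add_zero, zero_mul, sub_zero] at hs
    linarith [n.cast_nonneg (α := ℝ)]
  have := hRH s h0 htriv h1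
  linarith

/-- Growth of `ζ` away from the pole (from Titchmarsh (2.12.2), `ZetaFractionalPartIntegral`):
for `Re s > 1/2` and `|Im s| ≥ 1`, `‖ζ(s)‖ ≤ 3‖s‖`. [folklore] -/
lemma norm_riemannZeta_le_three_mul {s : ℂ} (hs : 1 / 2 < s.re) (hsi : 1 ≤ |s.im|) :
    ‖riemannZeta s‖ ≤ 3 * ‖s‖ := by
  have hs1 : s ≠ 1 := by
    intro h; rw [h] at hsi; simp at hsi; linarith
  have h := Literature.NumberTheory.LFunctions.norm_riemannZeta_le_of_re_pos (by linarith) hs1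
  have him : 1 ≤ ‖s - 1‖ := by
    have := abs_im_le_norm (s - 1)
    simp only [sub_im, one_im, sub_zero] at this
    linarith
  have hn : 0 ≤ ‖s‖ := norm_nonneg _
  have h1 : ‖s‖ / ‖s - 1‖ ≤ ‖s‖ := div_le_self hn him
  have h2 : ‖s‖ / s.re ≤ 2 * ‖s‖ := by
    rw [div_le_iff₀ (by linarith)]
    nlinarith
  linarith


/-! ### The discs (Titchmarsh §14.2, with centre `3 + it`) -/

/-- Centre `3 + it` of the Borel–Carathéodory disc and of the three circles. [folklore] -/
def ctr (t : ℝ) : ℂ := 3 + t * I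

/-- Radius `R₀ = 5/2 − δ/2` of the Borel–Carathéodory disc (inside `Re s > 1/2 + δ/2`).
[folklore] -/
def R₀ (δ : ℝ) : ℝ := 5 / 2 - δ / 2

/-- Radius `r₃ = 5/2 − δ` of the outer circle (through `1/2 + δ + it`). [folklore] -/
def r₃ (δ : ℝ) : ℝ := 5 / 2 - δ

/-- The constant `A₃ = 20 + 10 B₁` in the bound (14.2.2) `‖log ζ‖ ≤ A₃ δ⁻¹ log |t|`. [folklore] -/
def A₃ : ℝ := 20 + 10 * B₁

/-- `B₂ = max(B₁, 1)`, the bound used on the inner circle. [folklore] -/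
def B₂ : ℝ := max B₁ 1

/-- The exponent `a₀(δ) = log(5 − 4δ)/log(5 − 2δ) < 1` of the three-circles interpolation.
[folklore] -/
def a₀ (δ : ℝ) : ℝ := Real.log (5 - 4 * δ) / Real.log (5 - 2 * δ)

variable {δ t : ℝ}

/-- `Re (3 + it) = 3`. [folklore] -/
@[simp] lemma ctr_re (t : ℝ) : (ctr t).re = 3 := by simp [ctr]

/-- `Im (3 + it) = t`. [folklore] -/
@[simp] lemma ctr_im (t : ℝ) : (ctr t).im = t := by simp [ctr]

/-- `‖3 + it‖ ≤ 3 + |t|`. [folklore] -/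
lemma norm_ctr_le (t : ℝ) : ‖ctr t‖ ≤ 3 + |t| := by
  unfold ctr
  refine (norm_add_le _ _).trans ?_
  simp

/-- Points of the disc `‖z − (3+it)‖ < R₀` have `Re z > 1/2`. [folklore] -/
lemma re_gt_of_mem_ball (hδ : 0 < δ) {z : ℂ} (hz : z ∈ ball (ctr t) (R₀ δ)) : 1 / 2 < z.re := by
  rw [mem_ball, dist_eq_norm] at hz
  have h := abs_re_le_norm (z - ctr t)
  simp only [sub_re, ctr_re] at h
  unfold R₀ at hz
  have := neg_abs_le (z.re - 3)
  linarith

/-- Points of the disc `‖z − (3+it)‖ < R₀` have `|Im z| ≥ 1` once `|t| ≥ 7`. [folklore] -/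
lemma one_le_abs_im_of_mem_ball (hδ : 0 < δ) (ht : 7 ≤ |t|) {z : ℂ}
    (hz : z ∈ ball (ctr t) (R₀ δ)) : 1 ≤ |z.im| := by
  rw [mem_ball, dist_eq_norm] at hz
  have h := abs_im_le_norm (z - ctr t)
  simp only [sub_im, ctr_im] at h
  unfold R₀ at hz
  have h1 : |t| - |z.im - t| ≤ |z.im| := by
    have := abs_sub_abs_le_abs_sub t z.im
    rw [abs_sub_comm] at this
    linarith
  linarith

/-- Points of the disc `‖z − (3+it)‖ < R₀` have `‖z‖ ≤ |t| + 11/2`. [folklore] -/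
lemma norm_le_of_mem_ball (hδ : 0 < δ) {z : ℂ} (hz : z ∈ ball (ctr t) (R₀ δ)) :
    ‖z‖ ≤ |t| + 11 / 2 := by
  rw [mem_ball, dist_eq_norm] at hz
  unfold R₀ at hz
  have h1 : ‖z‖ ≤ ‖ctr t‖ + ‖z - ctr t‖ := by
    have := norm_add_le (ctr t) (z - ctr t); rwa [add_sub_cancel] at this
  linarith [norm_ctr_le t]

/-- Points of the disc are `≠ 1` (`|t| ≥ 7`). [folklore] -/
lemma ne_one_of_mem_ball (hδ : 0 < δ) (ht : 7 ≤ |t|) {z : ℂ} (hz : z ∈ ball (ctr t) (R₀ δ)) :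
    z ≠ 1 := by
  intro h
  have := one_le_abs_im_of_mem_ball hδ ht hz
  rw [h] at this
  simp at this
  linarith

/-- `ζ` is holomorphic on the disc `‖z − (3+it)‖ < R₀` (`|t| ≥ 7`; the pole is far away).
[folklore] -/
lemma differentiableOn_riemannZeta_ball (hδ : 0 < δ) (ht : 7 ≤ |t|) :
    DifferentiableOn ℂ riemannZeta (ball (ctr t) (R₀ δ)) := fun _ hz =>
  (differentiableAt_riemannZeta (ne_one_of_mem_ball hδ ht hz)).differentiableWithinAt

/-- On the disc, `‖ζ(z)‖ ≤ |t|²` (`|t| ≥ 7`; from `‖ζ(z)‖ ≤ 3‖z‖ ≤ 3|t| + 33/2`). [folklore] -/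
lemma norm_riemannZeta_le_sq (hδ : 0 < δ) (ht : 7 ≤ |t|) {z : ℂ} (hz : z ∈ ball (ctr t) (R₀ δ)) :
    ‖riemannZeta z‖ ≤ |t| ^ 2 := by
  have h1 := norm_riemannZeta_le_three_mul (re_gt_of_mem_ball hδ hz)
    (one_le_abs_im_of_mem_ball hδ ht hz)
  have h2 := norm_le_of_mem_ball hδ hz
  have h3 : 0 ≤ (|t| - 7) * (|t| + 4) := mul_nonneg (by linarith) (by positivity)
  nlinarith

/-- `log |t| ≥ 1` for `|t| ≥ 7`. [folklore] -/
lemma one_le_log_abs (ht : 7 ≤ |t|) : 1 ≤ Real.log |t| := by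
  rw [Real.le_log_iff_exp_le (by linarith)]
  linarith [Real.exp_one_lt_three]

/-! ### The Borel–Carathéodory step: Titchmarsh (14.2.2) -/

/-- **Titchmarsh (14.2.2).** Under RH, for `0 < δ ≤ 1/2` and `|t| ≥ 7` there is a holomorphic
branch `L` of `log ζ` on the disc `‖z − (3+it)‖ < 5/2 − δ/2` (so on `Re z > 1/2 + δ/2`), equal to
the principal `log ζ(z)` for `Re z > 2`, with `‖L(z)‖ ≤ A₃ δ⁻¹ log|t|` on the closed disc of radius
`5/2 − δ`: Borel–Carathéodory (Mathlib `Complex.borelCaratheodory`) with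
`Re L = log|ζ| ≤ 2 log|t|`. [cite: Titchmarsh1986, Thm 14.2, eq. (14.2.2)] -/
theorem exists_log_riemannZeta (hRH : RiemannHypothesis) (hδ : 0 < δ) (hδ2 : δ ≤ 1 / 2)
    (ht : 7 ≤ |t|) :
    ∃ L : ℂ → ℂ, DifferentiableOn ℂ L (ball (ctr t) (R₀ δ)) ∧
      (∀ z ∈ ball (ctr t) (R₀ δ), exp (L z) = riemannZeta z) ∧
      (∀ z ∈ ball (ctr t) (R₀ δ), 2 < z.re → L z = log (riemannZeta z)) ∧
      ∀ z ∈ closedBall (ctr t) (r₃ δ), ‖L z‖ ≤ A₃ / δ * Real.log |t| := by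
  have hR₀ : 0 < R₀ δ := by unfold R₀; linarith
  set c : ℂ := ctr t with hc
  have hf := differentiableOn_riemannZeta_ball hδ ht
  have hf0 : ∀ z ∈ ball c (R₀ δ), riemannZeta z ≠ 0 := fun z hz =>
    riemannZeta_ne_zero_of_RH hRH (re_gt_of_mem_ball hδ hz)
  obtain ⟨L, hLd, hLc, hLder, hexp⟩ := exists_log_of_ball hR₀ hf hf0
  -- agreement with the principal logarithm on `V = disc ∩ {Re z > 2}`
  have hV : ∀ z ∈ ball c (R₀ δ), 2 < z.re → L z = log (riemannZeta z) := by
    set V : Set ℂ := ball c (R₀ δ) ∩ {z : ℂ | 2 < z.re} with hVdef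
    have hVo : IsOpen V := isOpen_ball.inter (isOpen_lt continuous_const continuous_re)
    have hVc : IsPreconnected V :=
      ((convex_ball _ _).inter (convex_halfSpace_re_gt 2)).isPreconnected
    have hcV : c ∈ V := ⟨mem_ball_self hR₀, by simp only [Set.mem_setOf_eq, hc, ctr_re]; norm_num⟩
    have hne1 : ∀ z ∈ V, z ≠ 1 := by
      rintro z ⟨-, hz⟩ rfl
      norm_num at hz
    have hLV : DifferentiableOn ℂ L V := hLd.mono inter_subset_left
    have hlogV : DifferentiableOn ℂ (fun z => log (riemannZeta z)) V := by
      intro z hz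
      exact ((differentiableAt_riemannZeta (hne1 z hz)).clog
        (riemannZeta_mem_slitPlane (le_of_lt hz.2))).differentiableWithinAt
    have hder : V.EqOn (deriv L) (deriv fun z => log (riemannZeta z)) := by
      intro z hz
      rw [(hLder z hz.1).deriv, ((differentiableAt_riemannZeta (hne1 z hz)).hasDerivAt.clog
        (riemannZeta_mem_slitPlane (le_of_lt hz.2))).deriv]
    have heq := hVo.eqOn_of_deriv_eq hVc hLV hlogV hder hcV hLc
    intro z hz hz2
    exact heq ⟨hz, hz2⟩
  refine ⟨L, hLd, hexp, hV, ?_⟩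
  -- Borel–Carathéodory on the disc, translated to the origin
  intro z hz
  have hlog1 : 1 ≤ Real.log |t| := one_le_log_abs ht
  set M : ℝ := 2 * Real.log |t| with hM
  have hM0 : 0 < M := by rw [hM]; linarith
  set f₀ : ℂ → ℂ := fun w => L (c + w) with hf₀
  have hshift : ∀ w ∈ ball (0 : ℂ) (R₀ δ), c + w ∈ ball c (R₀ δ) := by
    intro w hw
    rw [mem_ball_zero_iff] at hw
    rwa [mem_ball, dist_eq_norm, add_sub_cancel_left]
  have hf₀d : DifferentiableOn ℂ f₀ (ball 0 (R₀ δ)) := by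
    intro w hw
    exact ((hLd.differentiableAt (isOpen_ball.mem_nhds (hshift w hw))).comp w
      ((differentiableAt_const c).add differentiableAt_id)).differentiableWithinAt
  have hmaps : MapsTo f₀ (ball 0 (R₀ δ)) {w | w.re ≤ M} := by
    intro w hw
    have hcw := hshift w hw
    show (L (c + w)).re ≤ M
    have hre : (L (c + w)).re = Real.log ‖riemannZeta (c + w)‖ := by
      rw [← hexp _ hcw, norm_exp, Real.log_exp]
    rw [hre]
    have hζpos : 0 < ‖riemannZeta (c + w)‖ := norm_pos_iff.mpr (hf0 _ hcw)
    calc Real.log ‖riemannZeta (c + w)‖ ≤ Real.log (|t| ^ 2) :=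
          Real.log_le_log hζpos (norm_riemannZeta_le_sq hδ ht hcw)
      _ = M := by rw [Real.log_pow, hM]; norm_num
  have hzc : ‖z - c‖ ≤ r₃ δ := by rwa [mem_closedBall, dist_eq_norm] at hz
  have hr₃R : r₃ δ < R₀ δ := by unfold r₃ R₀; linarith
  have hw : z - c ∈ ball (0 : ℂ) (R₀ δ) := by
    rw [mem_ball_zero_iff]; exact hzc.trans_lt hr₃R
  have key := borelCaratheodory hM0 hf₀d hmaps hR₀ hw
  have hf₀z : f₀ (z - c) = L z := by simp [hf₀]
  have hf₀0 : f₀ 0 = log (riemannZeta c) := by simp only [hf₀, add_zero, hc]; exact hLc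
  rw [hf₀z, hf₀0] at key
  -- numerical bounds
  have hden : δ / 2 ≤ R₀ δ - ‖z - c‖ := by unfold R₀; unfold r₃ at hzc; linarith
  have hδ2pos : 0 < δ / 2 := by linarith
  have hBc : ‖log (riemannZeta c)‖ ≤ B₁ := norm_log_riemannZeta_le (by rw [hc, ctr_re]; norm_num)
  have hB₁ := B₁_pos
  have hr₃0 : 0 ≤ r₃ δ := by unfold r₃; linarith
  have h1 : 2 * M * ‖z - c‖ / (R₀ δ - ‖z - c‖) ≤ 2 * M * r₃ δ / (δ / 2) :=
    div_le_div₀ (by positivity) (by gcongr) hδ2pos hden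
  have h2 : ‖log (riemannZeta c)‖ * (R₀ δ + ‖z - c‖) / (R₀ δ - ‖z - c‖) ≤
      B₁ * (R₀ δ + r₃ δ) / (δ / 2) :=
    div_le_div₀ (by positivity) (by gcongr) hδ2pos hden
  have h3 : 2 * M * r₃ δ / (δ / 2) + B₁ * (R₀ δ + r₃ δ) / (δ / 2) =
      (4 * M * r₃ δ + 2 * B₁ * (R₀ δ + r₃ δ)) / δ := by
    field_simp
    ring
  have h4 : 4 * M * r₃ δ + 2 * B₁ * (R₀ δ + r₃ δ) ≤ A₃ * Real.log |t| := by
    unfold A₃ r₃ R₀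
    rw [hM]
    nlinarith
  calc ‖L z‖ ≤ 2 * M * ‖z - c‖ / (R₀ δ - ‖z - c‖) +
        ‖log (riemannZeta c)‖ * (R₀ δ + ‖z - c‖) / (R₀ δ - ‖z - c‖) := key
    _ ≤ 2 * M * r₃ δ / (δ / 2) + B₁ * (R₀ δ + r₃ δ) / (δ / 2) := add_le_add h1 h2
    _ = (4 * M * r₃ δ + 2 * B₁ * (R₀ δ + r₃ δ)) / δ := h3
    _ ≤ (A₃ * Real.log |t|) / δ := div_le_div_of_nonneg_right h4 hδ.le
    _ = A₃ / δ * Real.log |t| := by ring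

/-! ### The three-circles step -/

/-- `a₀(δ) < 1`. [folklore] -/
lemma a₀_lt_one (hδ : 0 < δ) (hδ2 : δ ≤ 1 / 2) : a₀ δ < 1 := by
  unfold a₀
  rw [div_lt_one (Real.log_pos (by linarith))]
  exact Real.log_lt_log (by linarith) (by linarith)

/-- `0 ≤ a₀(δ)`. [folklore] -/
lemma a₀_nonneg (hδ : 0 < δ) (hδ2 : δ ≤ 1 / 2) : 0 ≤ a₀ δ := by
  unfold a₀
  exact div_nonneg (Real.log_nonneg (by linarith)) (Real.log_nonneg (by linarith))

/-- `1 ≤ B₂`. [folklore] -/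
lemma one_le_B₂ : 1 ≤ B₂ := le_max_right _ _

/-- `40 ≤ A₃/δ` for `0 < δ ≤ 1/2`. [folklore] -/
lemma forty_le_A₃_div (hδ : 0 < δ) (hδ2 : δ ≤ 1 / 2) : 40 ≤ A₃ / δ := by
  rw [le_div_iff₀ hδ]
  unfold A₃
  nlinarith [B₁_pos]

/-- **Three-circles interpolation** (Titchmarsh §14.2): with `L` as in `exists_log_riemannZeta`,
circles centred `3 + it` through `5/2 + it` (`‖L‖ ≤ B₂` there, principal branch), `σ + it`, and
`1/2 + δ + it` (`‖L‖ ≤ A₃δ⁻¹ log|t|` by (14.2.2)) give, for `1/2 + 2δ ≤ σ ≤ 5/2`,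
`‖L(σ+it)‖ ≤ B₂ (A₃ δ⁻¹ log|t|)^{a₀(δ)}` with `a₀(δ) < 1`.
[cite: Titchmarsh1986, Thm 14.2 (proof, three-circles step)] -/
theorem norm_log_le_rpow (hδ : 0 < δ) (hδ2 : δ ≤ 1 / 2) (ht : 7 ≤ |t|) {L : ℂ → ℂ}
    (hLd : DifferentiableOn ℂ L (ball (ctr t) (R₀ δ)))
    (hV : ∀ z ∈ ball (ctr t) (R₀ δ), 2 < z.re → L z = log (riemannZeta z))
    (hM₃ : ∀ z ∈ closedBall (ctr t) (r₃ δ), ‖L z‖ ≤ A₃ / δ * Real.log |t|)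
    {σ : ℝ} (hσ₁ : 1 / 2 + 2 * δ ≤ σ) (hσ₂ : σ ≤ 5 / 2) :
    ‖L (σ + t * I)‖ ≤ B₂ * (A₃ / δ * Real.log |t|) ^ a₀ δ := by
  set c : ℂ := ctr t with hc
  set M₃ : ℝ := A₃ / δ * Real.log |t| with hM₃def
  have hlog1 : 1 ≤ Real.log |t| := one_le_log_abs ht
  have h40 := forty_le_A₃_div hδ hδ2
  have hM₃1 : 1 ≤ M₃ := by rw [hM₃def]; nlinarith
  have hR₀ : 0 < R₀ δ := by unfold R₀; linarith
  have h13 : (1 / 2 : ℝ) < r₃ δ := by unfold r₃; linarith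
  have h3R : r₃ δ < R₀ δ := by unfold r₃ R₀; linarith
  -- bounds on the two circles
  have hM₁ : ∀ z : ℂ, ‖z - c‖ = 1 / 2 → ‖L z‖ ≤ B₂ := by
    intro z hz
    have hzb : z ∈ ball c (R₀ δ) := by
      rw [mem_ball, dist_eq_norm, hz]; unfold R₀; linarith
    have hzre : 2 < z.re := by
      have h := abs_re_le_norm (z - c)
      rw [hz] at h
      simp only [sub_re, hc, ctr_re] at h
      have := le_abs_self (z.re - 3)
      have := neg_abs_le (z.re - 3)
      linarith
    rw [hV z hzb hzre]
    exact (norm_log_riemannZeta_le hzre.le).trans (le_max_left _ _)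
  have hM₃' : ∀ z : ℂ, ‖z - c‖ = r₃ δ → ‖L z‖ ≤ M₃ := fun z hz =>
    hM₃ z (by rw [mem_closedBall, dist_eq_norm, hz])
  -- the point `σ + it`
  set z : ℂ := σ + t * I with hzdef
  have hzc : z - c = ((σ - 3 : ℝ) : ℂ) := by
    simp only [hzdef, hc, ctr]; push_cast; ring
  have hnorm : ‖z - c‖ = 3 - σ := by
    rw [hzc, Complex.norm_real, Real.norm_eq_abs, abs_of_nonpos (by linarith)]; ring
  have hz₁ : 1 / 2 ≤ ‖z - c‖ := by rw [hnorm]; linarith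
  have hz₃ : ‖z - c‖ ≤ r₃ δ := by rw [hnorm]; unfold r₃; linarith
  have key := norm_le_of_three_circles (by norm_num) h13 h3R hLd hM₁ hM₃' hz₁ hz₃
  -- the exponent
  set a : ℝ := Real.log (‖z - c‖ / (1 / 2)) / Real.log (r₃ δ / (1 / 2)) with hadef
  have hden : 0 < Real.log (r₃ δ / (1 / 2)) := Real.log_pos (by unfold r₃; linarith)
  have ha0 : 0 ≤ a := div_nonneg (Real.log_nonneg (by rw [hnorm]; linarith)) hden.le
  have ha1 : a ≤ a₀ δ := by
    rw [hadef, hnorm]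
    unfold a₀ r₃
    rw [show (3 - σ) / (1 / 2) = 6 - 2 * σ by ring,
      show (5 / 2 - δ) / (1 / 2 : ℝ) = 5 - 2 * δ by ring]
    exact div_le_div_of_nonneg_right (Real.log_le_log (by linarith) (by linarith))
      (Real.log_pos (by linarith)).le
  have ha1' : a ≤ 1 := ha1.trans (a₀_lt_one hδ hδ2).le
  have hB₂ := one_le_B₂
  have e1 : B₂ ^ (1 - a) ≤ B₂ := by
    calc B₂ ^ (1 - a) ≤ B₂ ^ (1 : ℝ) := Real.rpow_le_rpow_of_exponent_le hB₂ (by linarith)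
      _ = B₂ := Real.rpow_one _
  have e2 : M₃ ^ a ≤ M₃ ^ a₀ δ := Real.rpow_le_rpow_of_exponent_le hM₃1 ha1
  calc ‖L z‖ ≤ B₂ ^ (1 - a) * M₃ ^ a := key
    _ ≤ B₂ * M₃ ^ a₀ δ :=
        mul_le_mul e1 e2 (Real.rpow_nonneg (by linarith) _) (by linarith)

/-! ### Titchmarsh (14.2.6) -/

/-- **Littlewood 1912; Titchmarsh 1986, Thm. 14.2, eq. (14.2.6): under RH, `1/ζ(s) = O(t^ε)` for
every `σ > 1/2`**, uniformly in `σ ≥ σ₀ > 1/2`: for every `σ₀ > 1/2` and `ε > 0` there is `T`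
with `‖ζ(σ+it)⁻¹‖ ≤ |t|^ε` for all `σ ≥ σ₀`, `|t| ≥ T`. Proof (Titchmarsh §14.2): with
`δ = min((σ₀ − 1/2)/2, 1/2)`, (14.2.2) and the three-circles step give
`log|1/ζ(σ+it)| = −Re L ≤ ‖L(σ+it)‖ ≤ B₂ (A₃δ⁻¹ log|t|)^{a₀} ≤ ε log|t|` for `log|t|` large
(as `a₀ < 1`) when `σ ≤ 5/2`; for `σ ≥ 5/2`, `‖1/ζ‖ ≤ (1 − ρ)⁻¹`.
[cite: Titchmarsh1986, Thm 14.2, eq. (14.2.6)] -/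
theorem norm_inv_riemannZeta_le_rpow (hRH : RiemannHypothesis) {σ₀ : ℝ} (hσ₀ : 1 / 2 < σ₀)
    {ε : ℝ} (hε : 0 < ε) :
    ∃ T : ℝ, ∀ σ t : ℝ, σ₀ ≤ σ → T ≤ |t| → ‖(riemannZeta (σ + t * I))⁻¹‖ ≤ |t| ^ ε := by
  set δ : ℝ := min ((σ₀ - 1 / 2) / 2) (1 / 2) with hδdef
  have hδ : 0 < δ := lt_min (by linarith) (by norm_num)
  have hδ2 : δ ≤ 1 / 2 := min_le_right _ _
  have hσδ : 1 / 2 + 2 * δ ≤ σ₀ := by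
    have := min_le_left ((σ₀ - 1 / 2) / 2) (1 / 2)
    rw [← hδdef] at this
    linarith
  set K : ℝ := A₃ / δ with hK
  have hK40 : 40 ≤ K := forty_le_A₃_div hδ hδ2
  set a : ℝ := a₀ δ with ha
  have ha1 : a < 1 := a₀_lt_one hδ hδ2
  have ha0 : 0 ≤ a := a₀_nonneg hδ hδ2
  have hB₂ := one_le_B₂
  set Y : ℝ := (B₂ * K / ε) ^ (1 / (1 - a)) with hY
  have hY0 : 0 ≤ Y := Real.rpow_nonneg (by positivity) _
  have hρ := rho_lt_one
  set T : ℝ := max (max 7 (Real.exp Y)) (((1 - rho)⁻¹) ^ (1 / ε)) with hT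
  refine ⟨T, fun σ t hσ ht => ?_⟩
  have ht7 : 7 ≤ |t| := le_trans (le_max_left _ _) (le_trans (le_max_left _ _) ht)
  have htY : Real.exp Y ≤ |t| := le_trans (le_max_right _ _) (le_trans (le_max_left _ _) ht)
  have htρ : ((1 - rho)⁻¹) ^ (1 / ε) ≤ |t| := le_trans (le_max_right _ _) ht
  have htpos : 0 < |t| := by linarith
  have hlog1 : 1 ≤ Real.log |t| := one_le_log_abs ht7
  have hlogY : Y ≤ Real.log |t| := (Real.le_log_iff_exp_le htpos).mpr htY
  by_cases hσ5 : σ ≤ 5 / 2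
  · obtain ⟨L, hLd, hexp, hV, hM₃⟩ := exists_log_riemannZeta hRH hδ hδ2 ht7
    set z : ℂ := σ + t * I with hzdef
    have hzball : z ∈ ball (ctr t) (R₀ δ) := by
      have hzc : z - ctr t = ((σ - 3 : ℝ) : ℂ) := by
        simp only [hzdef, ctr]; push_cast; ring
      rw [mem_ball, dist_eq_norm, hzc, Complex.norm_real, Real.norm_eq_abs,
        abs_of_nonpos (by linarith)]
      unfold R₀; linarith
    have hLz : ‖L z‖ ≤ B₂ * (K * Real.log |t|) ^ a :=
      norm_log_le_rpow hδ hδ2 ht7 hLd hV hM₃ (hσδ.trans hσ) hσ5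
    -- `B₂ (K log|t|)^a ≤ ε log|t|`
    have hK1 : 1 ≤ K := by linarith
    have hKa : (K * Real.log |t|) ^ a ≤ K * Real.log |t| ^ a := by
      rw [Real.mul_rpow (by linarith) (by linarith)]
      gcongr
      calc K ^ a ≤ K ^ (1 : ℝ) := Real.rpow_le_rpow_of_exponent_le hK1 ha1.le
        _ = K := Real.rpow_one K
    have hpow : B₂ * K / ε ≤ Real.log |t| ^ (1 - a) := by
      have h1 : Y ^ (1 - a) = B₂ * K / ε := by
        rw [hY, ← Real.rpow_mul (by positivity), one_div_mul_cancel (by linarith), Real.rpow_one]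
      rw [← h1]
      exact Real.rpow_le_rpow hY0 hlogY (by linarith)
    have hsplit : Real.log |t| = Real.log |t| ^ a * Real.log |t| ^ (1 - a) := by
      rw [← Real.rpow_add (by linarith)]; norm_num
    have hmain : B₂ * (K * Real.log |t| ^ a) ≤ ε * Real.log |t| := by
      have hla : 0 ≤ Real.log |t| ^ a := Real.rpow_nonneg (by linarith) _
      calc B₂ * (K * Real.log |t| ^ a) = (B₂ * K / ε) * ε * Real.log |t| ^ a := by
            field_simp
        _ ≤ Real.log |t| ^ (1 - a) * ε * Real.log |t| ^ a := by gcongr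
        _ = ε * (Real.log |t| ^ a * Real.log |t| ^ (1 - a)) := by ring
        _ = ε * Real.log |t| := by rw [← hsplit]
    have hLz' : ‖L z‖ ≤ ε * Real.log |t| := by
      calc ‖L z‖ ≤ B₂ * (K * Real.log |t|) ^ a := hLz
        _ ≤ B₂ * (K * Real.log |t| ^ a) := by gcongr
        _ ≤ ε * Real.log |t| := hmain
    -- `‖ζ(z)⁻¹‖ = exp(-Re L z) ≤ exp ‖L z‖ ≤ |t|^ε`
    have hinv : (riemannZeta z)⁻¹ = exp (-L z) := by rw [exp_neg, hexp z hzball]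
    rw [hinv, norm_exp, Real.rpow_def_of_pos htpos]
    refine Real.exp_le_exp.mpr ?_
    have : -(L z).re ≤ ‖L z‖ := by
      have := abs_re_le_norm (L z)
      have := neg_abs_le (L z).re
      linarith
    simp only [neg_re]
    nlinarith
  · -- `σ > 5/2`: `‖ζ⁻¹‖ ≤ (1 - ρ)⁻¹ ≤ |t|^ε`
    have hσ2 : 2 ≤ ((σ : ℂ) + t * I).re := by simp; linarith
    refine (norm_inv_riemannZeta_le_of_two_le hσ2).trans ?_
    have hbase : 0 ≤ (1 - rho)⁻¹ := inv_nonneg.mpr (by linarith)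
    calc (1 - rho)⁻¹ = (((1 - rho)⁻¹) ^ (1 / ε)) ^ ε := by
          rw [← Real.rpow_mul hbase, one_div_mul_cancel hε.ne', Real.rpow_one]
      _ ≤ |t| ^ ε := Real.rpow_le_rpow (Real.rpow_nonneg hbase _) htρ hε.le

end InvZetaRH

end Literature.NumberTheory.LFunctions

end
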